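import Mathlib.NumberTheory.Padics.PadicVal.Basic
import Mathlib.NumberTheory.LegendreSymbol.Basic
import Mathlib.Data.Nat.Squarefree
import Mathlib.Data.ZMod.Basic
import Literature.NumberTheory.EllipticCurves.TwoDescent
import HarnessLib

/-!
# Square classes of rationals: sign and valuation-parity characters of `ℚ*/ℚ*²`

Elementary glue for explicit `2`-descents over `ℚ` (used by Kramer's bound,
`KramerTwoDescentBound.lean`; K. Kramer, Proc. AMS 89 (1983) [Kramer1983], §5, where
`S(A/2A) ⊆ (ℚ*/ℚ*²)³` is confined by signs and valuation parities): on the group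
`SqUnits ℚ = ℚˣ/(ℚˣ)²` of the tree's complete `2`-descent (`TwoDescent.lean`,
Silverman AEC X.1.4),

* `signBit`, `parityBit p` (`v_p mod 2`) and the characters `signHom`,
  `parityHom p : Additive (SqUnits ℚ) →+ ℤ/2` they induce (`signHom_sqClass`,
  `parityHom_sqClass`);
* `exists_sq_of_even_padicValRat` — a positive rational all of whose valuations are even is
  a square (unique factorisation), and `sqClass_eq_one_of_forall`;
* `padicValRat_prod_primes`, `exists_eq_prod_mul_sq` — the square-free kernel: if the
  odd-valuation primes of `d > 0` form the finite set `S` then `d = (∏ S) r²`;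
* `legendreSym_prod` — multiplicativity of the Legendre symbol over a `Finset` product.

All statements are folklore; no new mathematics. `ℚ*/ℚ*² ≅ {±1} × ⊕_p ℤ/2` is not
formalised as an isomorphism — only the characters needed downstream.

## References

* J. H. Silverman, *The Arithmetic of Elliptic Curves*, 2nd ed. (2009), Prop. X.1.4 and
  Thm. X.1.1(c) (`K(S, 2)`). [SilvermanAEC2009]
* K. Kramer, Proc. Amer. Math. Soc. 89 (1983) 379–386, §5 (pp. 383–384). [Kramer1983]
-/

noncomputable section

namespace Literature.NumberTheory.EllipticCurves.KramerTwoDescent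

open WeierstrassCurve.Affine

/-! ### Rationals with even valuations are squares -/

/-- A positive natural number all of whose prime exponents are even is a perfect square
(unique factorisation; via Mathlib's `Nat.sq_mul_squarefree_of_pos`). [folklore] -/
theorem nat_exists_sq_of_even_padicValNat {n : ℕ} (hn : 0 < n)
    (h : ∀ p : ℕ, p.Prime → Even (padicValNat p n)) : ∃ k : ℕ, n = k ^ 2 := by
  obtain ⟨a, b, ha, hb, hab, hsq⟩ := Nat.sq_mul_squarefree_of_pos hn
  suffices a = 1 by subst this; exact ⟨b, by rw [← hab, mul_one]⟩
  by_contra ha1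
  obtain ⟨p, hp, hpa⟩ := Nat.exists_prime_and_dvd ha1
  haveI : Fact p.Prime := ⟨hp⟩
  have hfa : a.factorization p = 1 :=
    le_antisymm (Squarefree.natFactorization_le_one p hsq)
      ((Nat.Prime.dvd_iff_one_le_factorization hp ha.ne').mp hpa)
  have hev := h p hp
  rw [← hab, padicValNat.mul (pow_ne_zero 2 hb.ne') ha.ne', padicValNat.pow b 2,
    ← Nat.factorization_def a hp, hfa] at hev
  obtain ⟨k, hk⟩ := hev
  omega

/-- **A positive rational all of whose `p`-adic valuations are even is a square.**
[folklore] -/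
theorem exists_sq_of_even_padicValRat {a : ℚ} (ha : 0 < a)
    (h : ∀ p : ℕ, p.Prime → Even (padicValRat p a)) : ∃ r : ℚ, a = r ^ 2 := by
  have hnum : 0 < a.num := Rat.num_pos.mpr ha
  have hcop : a.num.natAbs.Coprime a.den := a.reduced
  have key : ∀ p : ℕ, p.Prime → Even (padicValNat p a.num.natAbs) ∧ Even (padicValNat p a.den) := by
    intro p hp
    have hv : padicValRat p a = (padicValNat p a.num.natAbs : ℤ) - (padicValNat p a.den : ℤ) := by
      rw [padicValRat_def]; rfl
    have hev := h p hp
    rw [hv] at hev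
    have hnot : ¬ (p ∣ a.num.natAbs ∧ p ∣ a.den) := fun ⟨h1, h2⟩ =>
      hp.ne_one (Nat.eq_one_of_dvd_coprimes hcop h1 h2)
    by_cases h1 : p ∣ a.num.natAbs
    · have h2 : padicValNat p a.den = 0 := padicValNat.eq_zero_of_not_dvd fun h2 => hnot ⟨h1, h2⟩
      rw [h2] at hev ⊢
      refine ⟨?_, ⟨0, rfl⟩⟩
      obtain ⟨k, hk⟩ := hev
      exact ⟨k.toNat, by omega⟩
    · have h1' : padicValNat p a.num.natAbs = 0 := padicValNat.eq_zero_of_not_dvd h1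
      rw [h1'] at hev ⊢
      refine ⟨⟨0, rfl⟩, ?_⟩
      obtain ⟨k, hk⟩ := hev
      exact ⟨(-k).toNat, by omega⟩
  obtain ⟨k, hk⟩ := nat_exists_sq_of_even_padicValNat (Int.natAbs_pos.mpr hnum.ne')
    fun p hp => (key p hp).1
  obtain ⟨l, hl⟩ := nat_exists_sq_of_even_padicValNat a.den_pos fun p hp => (key p hp).2
  refine ⟨(k : ℚ) / l, ?_⟩
  have hnumk : (a.num : ℚ) = (k : ℚ) ^ 2 := by
    have : a.num = (a.num.natAbs : ℤ) := (Int.natAbs_of_nonneg hnum.le).symm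
    rw [this, hk]; push_cast; ring
  have hdenl : (a.den : ℚ) = (l : ℚ) ^ 2 := by rw [hl]; push_cast; ring
  rw [← Rat.num_div_den a, hnumk, hdenl, div_pow]


/-! ### Sign and valuation parities as characters of `ℚ*/ℚ*²` -/

section Characters

/-- The sign bit of a rational: `1 ∈ ℤ/2` if negative, `0` otherwise. [folklore] -/
def signBit (a : ℚ) : ZMod 2 := if a < 0 then 1 else 0

/-- `signBit` is additive on non-zero rationals. [folklore] -/
theorem signBit_mul {a b : ℚ} (ha : a ≠ 0) (hb : b ≠ 0) :
    signBit (a * b) = signBit a + signBit b := by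
  unfold signBit
  rcases lt_or_gt_of_ne ha with ha' | ha' <;> rcases lt_or_gt_of_ne hb with hb' | hb'
  · rw [if_neg (not_lt.mpr (mul_pos_of_neg_of_neg ha' hb').le), if_pos ha', if_pos hb']; decide
  · rw [if_pos (mul_neg_of_neg_of_pos ha' hb'), if_pos ha', if_neg (not_lt.mpr hb'.le)]; decide
  · rw [if_pos (mul_neg_of_pos_of_neg ha' hb'), if_neg (not_lt.mpr ha'.le), if_pos hb']; decide
  · rw [if_neg (not_lt.mpr (mul_pos ha' hb').le), if_neg (not_lt.mpr ha'.le),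
      if_neg (not_lt.mpr hb'.le)]; decide

/-- `signBit a = 0` iff `0 < a`, for `a ≠ 0`. [folklore] -/
theorem signBit_eq_zero_iff {a : ℚ} (ha : a ≠ 0) : signBit a = 0 ↔ 0 < a := by
  unfold signBit
  rcases lt_or_gt_of_ne ha with h | h
  · rw [if_pos h]; exact ⟨fun h0 => absurd h0 (by decide), fun h' => absurd h (not_lt.mpr h'.le)⟩
  · rw [if_neg (not_lt.mpr h.le)]; exact ⟨fun _ => h, fun _ => rfl⟩

/-- The parity `v_p(a) mod 2 ∈ ℤ/2` of the `p`-adic valuation of a rational. [folklore] -/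
def parityBit (p : ℕ) (a : ℚ) : ZMod 2 := (padicValRat p a : ZMod 2)

/-- `parityBit p` is additive on non-zero rationals. [folklore] -/
theorem parityBit_mul {p : ℕ} [Fact p.Prime] {a b : ℚ} (ha : a ≠ 0) (hb : b ≠ 0) :
    parityBit p (a * b) = parityBit p a + parityBit p b := by
  unfold parityBit
  rw [padicValRat.mul ha hb, Int.cast_add]

/-- `parityBit p a = 0` iff `v_p(a)` is even. [folklore] -/
theorem parityBit_eq_zero_iff {p : ℕ} {a : ℚ} : parityBit p a = 0 ↔ Even (padicValRat p a) := by
  unfold parityBit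
  rw [ZMod.intCast_zmod_eq_zero_iff_dvd, even_iff_two_dvd]; rfl

/-- The sign character `ℚˣ → ℤ/2` (multiplicatively written target). [folklore] -/
def signUnitsHom : ℚˣ →* Multiplicative (ZMod 2) where
  toFun u := Multiplicative.ofAdd (signBit (u : ℚ))
  map_one' := by
    rw [Units.val_one, (signBit_eq_zero_iff one_ne_zero).mpr one_pos]; rfl
  map_mul' u v := by
    rw [← ofAdd_add, Units.val_mul, signBit_mul u.ne_zero v.ne_zero]

/-- The `p`-adic parity character `ℚˣ → ℤ/2` (multiplicatively written target). [folklore] -/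
def parityUnitsHom (p : ℕ) [Fact p.Prime] : ℚˣ →* Multiplicative (ZMod 2) where
  toFun u := Multiplicative.ofAdd (parityBit p (u : ℚ))
  map_one' := by
    rw [Units.val_one]; unfold parityBit; rw [padicValRat.one, Int.cast_zero]; rfl
  map_mul' u v := by
    rw [← ofAdd_add, Units.val_mul, parityBit_mul u.ne_zero v.ne_zero]

/-- Unfolding `signUnitsHom`. [folklore] -/
@[simp] theorem signUnitsHom_apply (u : ℚˣ) :
    signUnitsHom u = Multiplicative.ofAdd (signBit (u : ℚ)) := rfl

/-- Unfolding `parityUnitsHom`. [folklore] -/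
@[simp] theorem parityUnitsHom_apply (p : ℕ) [Fact p.Prime] (u : ℚˣ) :
    parityUnitsHom p u = Multiplicative.ofAdd (parityBit p (u : ℚ)) := rfl

/-- Squares have trivial sign. [folklore] -/
theorem range_powMonoidHom_le_ker_signUnitsHom :
    (powMonoidHom 2 : ℚˣ →* ℚˣ).range ≤ signUnitsHom.ker := by
  rintro _ ⟨w, rfl⟩
  rw [MonoidHom.mem_ker, powMonoidHom_apply, signUnitsHom_apply, Units.val_pow_eq_pow_val,
    (signBit_eq_zero_iff (pow_ne_zero 2 w.ne_zero)).mpr (by have := w.ne_zero; positivity), ofAdd_zero]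

/-- Squares have even valuations. [folklore] -/
theorem range_powMonoidHom_le_ker_parityUnitsHom (p : ℕ) [Fact p.Prime] :
    (powMonoidHom 2 : ℚˣ →* ℚˣ).range ≤ (parityUnitsHom p).ker := by
  rintro _ ⟨w, rfl⟩
  rw [MonoidHom.mem_ker, powMonoidHom_apply, parityUnitsHom_apply, Units.val_pow_eq_pow_val,
    parityBit_eq_zero_iff.mpr (by rw [padicValRat.pow]; exact even_two_mul _), ofAdd_zero]

/-- **The sign character of `ℚ*/ℚ*²`**, additively: `Additive (SqUnits ℚ) →+ ℤ/2`. [folklore] -/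
def signHom : Additive (SqUnits ℚ) →+ ZMod 2 :=
  MonoidHom.toAdditiveLeft
    (QuotientGroup.lift _ signUnitsHom range_powMonoidHom_le_ker_signUnitsHom)

/-- **The `p`-adic parity character of `ℚ*/ℚ*²`**, additively:
`Additive (SqUnits ℚ) →+ ℤ/2`, `a ↦ v_p(a) mod 2`. [folklore] -/
def parityHom (p : ℕ) [Fact p.Prime] : Additive (SqUnits ℚ) →+ ZMod 2 :=
  MonoidHom.toAdditiveLeft
    (QuotientGroup.lift _ (parityUnitsHom p) (range_powMonoidHom_le_ker_parityUnitsHom p))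

/-- Value of the sign character on the class of `a ≠ 0`. [folklore] -/
theorem signHom_sqClass {a : ℚ} (ha : a ≠ 0) :
    signHom (Additive.ofMul (sqClass a)) = signBit a := by
  rw [sqClass_of_ne_zero ha, signHom, MonoidHom.toAdditiveLeft]
  simp [signUnitsHom]

/-- Value of the parity character on the class of `a ≠ 0`. [folklore] -/
theorem parityHom_sqClass {p : ℕ} [Fact p.Prime] {a : ℚ} (ha : a ≠ 0) :
    parityHom p (Additive.ofMul (sqClass a)) = parityBit p a := by
  rw [sqClass_of_ne_zero ha, parityHom, MonoidHom.toAdditiveLeft]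
  simp [parityUnitsHom]

/-- A rational whose square class has trivial sign and all parities trivial is a square:
restatement of `exists_sq_of_even_padicValRat` on `ℚ*/ℚ*²`. [folklore] -/
theorem sqClass_eq_one_of_forall {a : ℚ} (ha : a ≠ 0) (hpos : 0 < a)
    (h : ∀ p : ℕ, p.Prime → Even (padicValRat p a)) : sqClass a = 1 := by
  obtain ⟨r, hr⟩ := exists_sq_of_even_padicValRat hpos h
  exact (sqClass_eq_one_iff ha).mpr ⟨r, hr⟩

end Characters

/-! ### Products of distinct primes -/

section PrimeProducts

/-- The `p`-adic valuation of a product of distinct primes is `1` or `0` according as `p`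
occurs. [folklore] -/
theorem padicValRat_prod_primes {S : Finset ℕ} (hS : ∀ q ∈ S, q.Prime) (p : ℕ) [Fact p.Prime] :
    padicValRat p (∏ q ∈ S, (q : ℚ)) = if p ∈ S then 1 else 0 := by
  classical
  induction S using Finset.induction_on with
  | empty => simp
  | insert a S ha ih =>
    have hSp : ∀ q ∈ S, q.Prime := fun q hq => hS q (Finset.mem_insert_of_mem hq)
    haveI : Fact a.Prime := ⟨hS a (Finset.mem_insert_self a S)⟩
    have ha0 : (a : ℚ) ≠ 0 := by exact_mod_cast (Fact.out : a.Prime).ne_zero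
    have hprod0 : (∏ q ∈ S, (q : ℚ)) ≠ 0 :=
      Finset.prod_ne_zero_iff.mpr fun q hq => by exact_mod_cast (hSp q hq).ne_zero
    rw [Finset.prod_insert ha, padicValRat.mul ha0 hprod0, ih hSp, padicValRat.of_nat]
    by_cases hpa : p = a
    · subst hpa
      rw [padicValNat_self, if_pos (Finset.mem_insert_self p S), if_neg ha]; rfl
    · rw [padicValNat_primes hpa]
      by_cases hpS : p ∈ S
      · rw [if_pos hpS, if_pos (Finset.mem_insert_of_mem hpS)]; rfl
      · rw [if_neg hpS, if_neg (by rw [Finset.mem_insert]; exact not_or.mpr ⟨hpa, hpS⟩)]; rfl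

/-- **Square-free kernel.** If the primes at which a positive rational `d` has odd
valuation are exactly those of the finite set `S`, then `d = (∏ S) · r²`. [folklore] -/
theorem exists_eq_prod_mul_sq {S : Finset ℕ} (hS : ∀ q ∈ S, q.Prime) {d : ℚ} (hd : 0 < d)
    (h : ∀ p : ℕ, p.Prime → (Even (padicValRat p d) ↔ p ∉ S)) :
    ∃ r : ℚ, d = (∏ q ∈ S, (q : ℚ)) * r ^ 2 := by
  have hprod : (0 : ℚ) < ∏ q ∈ S, (q : ℚ) :=
    Finset.prod_pos fun q hq => by exact_mod_cast (hS q hq).pos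
  obtain ⟨r, hr⟩ := exists_sq_of_even_padicValRat (div_pos hd hprod) fun p hp => by
    haveI : Fact p.Prime := ⟨hp⟩
    rw [padicValRat.div hd.ne' hprod.ne', padicValRat_prod_primes hS p]
    by_cases hpS : p ∈ S
    · rw [if_pos hpS]
      have hodd : ¬ Even (padicValRat p d) := fun he => (h p hp).mp he hpS
      rcases Int.even_or_odd (padicValRat p d) with he | ⟨k, hk⟩
      · exact absurd he hodd
      · exact ⟨k, by omega⟩
    · rw [if_neg hpS, sub_zero]
      exact (h p hp).mpr hpS
  exact ⟨r, by rw [← hr, mul_div_cancel₀ _ hprod.ne']⟩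

/-- The Legendre symbol of a product of primes. [folklore] -/
theorem legendreSym_prod (p : ℕ) [Fact p.Prime] {ι : Type*} (s : Finset ι) (f : ι → ℤ) :
    legendreSym p (∏ i ∈ s, f i) = ∏ i ∈ s, legendreSym p (f i) :=
  map_prod (legendreSym.hom p) f s

end PrimeProducts

end Literature.NumberTheory.EllipticCurves.KramerTwoDescent

end
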